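import Summits.PneNP.PneNP.Theses.PhaseTwins

/-!
# Route PhaseTwins, crux `PseudorandomTwinsAbove` (stmt-PneNP-2721) — negative side: kernels about the test class

Companion of `Negative/FalseWithoutPolyTime.lean` (crux stmt-PneNP-2721,
`Summit.PneNP.PneNP.Theses.PhaseTwins.PseudorandomTwinsAbove`), from the disprover's work file
`Summits/PneNP/PneNP/Cruxes/PseudorandomTwinsAbove/Disproof.lean`.

* `sideConditions_satisfiable`: the arithmetic guard `3 ≤ Δ ∧ 0 < q ∧ λ_c(Δ) < p/q` is satisfiable
  (`Δ = 3`, `λ = 5 > 4`), so nothing follows from the guard alone.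
* `isPolyTime_coinLen_irrelevant`: `RandAlg.IsPolyTime` bounds `coinLen` only polynomially, so the
  crux's distinguisher class is PPT with the non-uniform advice `coinLen |x|` (`O(log |x|)` bits,
  read off `|r|`). Consequence (informal): a sampler cannot diagonalise against the class — fooling
  one bit-selector machine for every coin length `ℓ ≤ |x|` forces equal samples — so the
  tiny-instance freedom of index-free tests does not make the crux cheaply provable.
* `exists_close_pair_of_card_lt`: pigeonhole kernel — against finitely many `[0,1]`-valued tests,
  among more than `(g+1)^{#tests}` inputs two are `1/g`-indistinguishable by all of them; along a
  chain with `N(x_{j+1}) ≥ 8 N(x_j)` such a pair is a factor-8 twin. Hence point masses fool any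
  finite list of tests, and samplability + an infinite uniform test family are exactly what makes
  the crux non-trivial.

References: O. Goldreich, *Foundations of Cryptography I* (2001), §3.2.2 (uniform vs non-uniform
distinguishers); O. Goldreich, H. Krawczyk, *Sparse pseudorandom distributions*, Random Struct.
Alg. 3 (1992) (non-samplable pseudorandom ensembles by counting). [folklore]
-/

namespace Summit.PneNP.PneNP.Theorems.PseudorandomTwinsAbove.Negative

open Literature.Computability.Complexity Literature.Computability.MetaComplexity

noncomputable section

/-! ## Side conditions on `(Δ, p, q)` are satisfiable (no arithmetic vacuity) -/

/-- `Δ = 3`, `λ = 5 > λ_c(3) = 2² / 1³ = 4`: the arithmetic guard of the crux is satisfiable, so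
nothing can be refuted (or proved) from the guard alone. [folklore] -/
theorem sideConditions_satisfiable :
    ∃ Δ p q : ℕ, 3 ≤ Δ ∧ 0 < q ∧ ((Δ : ℝ) - 1) ^ (Δ - 1) / ((Δ : ℝ) - 2) ^ Δ < (p : ℝ) / q :=
  ⟨3, 5, 1, le_rfl, Nat.one_pos, by norm_num⟩

/-! ## (b) `coinLen` is unconstrained advice -/

/-- `RandAlg.IsPolyTime` only bounds `coinLen` polynomially: replacing the coin budget of a PPT
test by ANY polynomially bounded function (computable or not) keeps it PPT. Hence the test class
of clause (i) is "PPT with the advice `coinLen |x|`", i.e. `O(log |x|)` advice bits read off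
`|r|`. [folklore] -/
theorem isPolyTime_coinLen_irrelevant (A : RandAlg (List Bool) Bool)
    (hA : A.IsPolyTime (id : List Bool → List Bool) Computability.encodeBool)
    (f : ℕ → ℕ) (pf : Polynomial ℕ) (hf : ∀ n, f n ≤ pf.eval n) :
    ({ run := A.run, coinLen := f } : RandAlg (List Bool) Bool).IsPolyTime
      (id : List Bool → List Bool) Computability.encodeBool :=
  ⟨hA.1, pf, hf⟩

/-! ## (c) Pigeonhole kernel: finitely many bounded tests always admit twins along a chain -/

/-- Against a FINITE family of `[0,1]`-valued tests, among more than `(g+1)^{#tests}` inputs two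
are `1/g`-indistinguishable by every test (box pigeonhole on `⌊g·aᵢ(x)⌋`). Along a chain with
`N(x_{j+1}) ≥ 8·N(x_j)` the pair is a factor-`8` twin. This is why the crux needs BOTH an
infinite (uniform) test family and samplable ensembles to be non-trivial: point masses on such a
pair fool any finite list of tests, and a diagonal enumeration of PPT tests would prove the crux
minus `IsPolySamplable`. [folklore] -/
theorem exists_close_pair_of_card_lt {ι Y : Type*} [Fintype ι] (a : ι → Y → ℝ)
    (ha : ∀ i y, a i y ∈ Set.Icc (0 : ℝ) 1) (g : ℕ) (hg : 0 < g) {M : ℕ} (xs : Fin M → Y)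
    (hM : (g + 1) ^ Fintype.card ι < M) :
    ∃ j k : Fin M, j ≠ k ∧ ∀ i, |a i (xs j) - a i (xs k)| ≤ 1 / g := by
  classical
  -- the cell of an input: coordinatewise ⌊g · aᵢ⌋ ∈ {0, …, g}
  have hcell : ∀ i y, ⌊(g : ℝ) * a i y⌋₊ < g + 1 := by
    intro i y
    have h1 : (g : ℝ) * a i y ≤ g := by
      have := (ha i y).2
      nlinarith [(Nat.cast_nonneg g : (0 : ℝ) ≤ g)]
    have h2 : ⌊(g : ℝ) * a i y⌋₊ ≤ g := by
      refine Nat.floor_le_of_le ?_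
      exact_mod_cast h1
    omega
  let cell : Fin M → (ι → Fin (g + 1)) := fun j i => ⟨⌊(g : ℝ) * a i (xs j)⌋₊, hcell i (xs j)⟩
  have hcard : Fintype.card (ι → Fin (g + 1)) < Fintype.card (Fin M) := by
    simpa [Fintype.card_fun, Fintype.card_fin] using hM
  obtain ⟨j, k, hjk, hjk'⟩ := Fintype.exists_ne_map_eq_of_card_lt cell hcard
  refine ⟨j, k, hjk, fun i => ?_⟩
  have hfl : ⌊(g : ℝ) * a i (xs j)⌋₊ = ⌊(g : ℝ) * a i (xs k)⌋₊ := by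
    have := congrArg (fun c : ι → Fin (g + 1) => (c i : ℕ)) hjk'
    simpa [cell] using this
  have hgpos : (0 : ℝ) < g := by exact_mod_cast hg
  have h0j : 0 ≤ (g : ℝ) * a i (xs j) := mul_nonneg hgpos.le (ha i (xs j)).1
  have h0k : 0 ≤ (g : ℝ) * a i (xs k) := mul_nonneg hgpos.le (ha i (xs k)).1
  have hj1 := Nat.floor_le h0j
  have hj2 := Nat.lt_floor_add_one ((g : ℝ) * a i (xs j))
  have hk1 := Nat.floor_le h0k
  have hk2 := Nat.lt_floor_add_one ((g : ℝ) * a i (xs k))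
  rw [hfl] at hj1 hj2
  have habs : |(g : ℝ) * a i (xs j) - (g : ℝ) * a i (xs k)| ≤ 1 := by
    rw [abs_le]; constructor <;> linarith
  rw [← mul_sub, abs_mul, abs_of_pos hgpos] at habs
  rw [le_div_iff₀ hgpos, mul_comm]
  exact habs

end

end Summit.PneNP.PneNP.Theorems.PseudorandomTwinsAbove.Negative
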